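import Mathlib
import Summits.ResolutionOfSingularities.ResolutionOfSingularities.Theorems.WeightedInvariantLocalWeightedDropTOT2BridgeDecoratedCurve
import Summits.ResolutionOfSingularities.ResolutionOfSingularities.Theorems.WeightedInvariantLocalWeightedDropNCPolyBridgePointMove
import Summits.ResolutionOfSingularities.ResolutionOfSingularities.Theorems.WeightedInvariantLocalWeightedDropNCResSettingPermissible

/-!
# `WeightedInvariant.LocalWeightedDrop`, TOT2-LINE v1.3 piece (P2), part 2: **THE SUCCESSOR PRESENTATIONS** — at a near answer of a move of the
# bridge the new decoration is again PRESENTED, by coordinates straightening every letter, with the successor label of the lazy strategy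

Crux item stmt-ResolutionOfSingularities-8899 `LocalWeightedDrop` (route `ResolutionOfSingularities/WeightedInvariant`), ENGINE skeleton v33 (candidate
35b29332b4d99231, res-L1-w43-lead-1 g5), stub `stub_regimePresented`; TOT2-LINE v1.3 §3 (P2) «same head presented by some `A′ ∈ succT c A`».
[OURS · L1 W4.3 · chain w43 · stub worker res-L1-w43-stub-2 (gen 5), dealt (P2); the DECORATED twin of the lead prover's `NCPoly.represents_of_sliceData` /
`represents_pointSucc_zero/one` / `represents_curveSucc_zero/one` (…NCPolyBridgePointMove/CurveMove), on this seat's δ-adapters …TOT2BridgeDecorated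
(`totalO_transform_eq_of_near`) and …TOT2BridgeDecoratedCurve (`totalO_transform_curve_eq_of_near′`) and the slice identifications of …PolyDescentBridgeSlices.
Nothing here is a statement of any manuscript; AI-produced, gate-checked, weaker than expert review.  Definition-free.]

* `NCPoly.extendLast_last`, **`NCPoly.isBPermissible_point_sliceTheta`** — the successor coordinates `Θ′ = (extendLast τ) ∘ (yScale γ₁)` straighten EVERY
  letter (so they are point-B-permissible for every decoration) when `τ` is a (swap-)diagonal plane change;
* **`Decoration.presentation_of_sliceData`** — TRANSFER: if `f′ · ∏_{O′} x_l = V · monicGerm d S` with `S_j = γ₁^{d−j} · (L_j ∘ σ)`, `τ` inverse to `σ`,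
  then `Θ′` presents the new state by the label `L`: `(f′ · ∏_{O′} x_l) ∘ Θ′ = H′ · monicGerm d L`, `H′(0) ≠ 0`, with `Θ′` legal, letter-straightening,
  `u`-letters ↦ `u`-letters and `y ↦ γ₁ y`;
* the four near answers of a presented state `(f · ∏_O x_l) ∘ Φ₀ = U · monicGerm d A` (head kept):
  **`Decoration.presentation_pointSucc_zero`** (point move, `γ = 0`, `c₀ ≠ 0`, slot `u₁`: label `blowOneT d (shearT (C (c₁/c₀)) A)`),
  **`Decoration.presentation_pointSucc_one`** (`c₀ = 0`, `c₁ ≠ 0`, slot `u₂`: label `blowTwoT d A`),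
  **`Decoration.presentation_curveSucc_zero`** / **`_one`** (curve move `V(y,u_i)`, `γ = 0`, slot `u_i`: label `A′ = A / u_i^{d−·}`).
-/

set_option linter.dupNamespace false -- mandated namespace of this single-conjunct summit

noncomputable section

namespace Summit.ResolutionOfSingularities.ResolutionOfSingularities.Theorems

open MvPowerSeries Literature.AlgebraicGeometry.Resolution

variable {k : Type} [Field k]

namespace NCPoly

open TameFourTupleDrop

/-- `extendLast τ` fixes `y`. -/
theorem extendLast_last (τ : Fin 2 → MvPowerSeries (Fin 2) k) : extendLast τ (Fin.last 2) = X (Fin.last 2) := by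
  unfold extendLast
  exact Fin.lastCases_last

/-- **THE SUCCESSOR COORDINATES STRAIGHTEN EVERY LETTER**: if every `τ i` is `C a · X j` with `a ≠ 0` and `γ₁ ≠ 0`, then
`Θ′ = (l ↦ (extendLast τ l) ∘ yScale γ₁)` is a legal move mapping each letter to a unit multiple of a letter — B-permissible for the point centre of ANY
decoration. -/
theorem isBPermissible_point_sliceTheta (δ : Decoration k 2) {γ₁ : k} (hγ₁ : γ₁ ≠ 0) (τ : Fin 2 → MvPowerSeries (Fin 2) k)
    (hτ0 : ∀ i, constantCoeff (τ i) = 0) (hτdet : IsUnit (FormalCoordChange.linMat τ).det)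
    (hτX : ∀ i, ∃ (j : Fin 2) (a : k), a ≠ 0 ∧ τ i = C a * X j) :
    IsBPermissible δ (fun i => subst (yScale γ₁) (extendLast τ i)) (fun _ => 1) := by
  have hΘ₁0 := constantCoeff_extendLast' τ hτ0
  have hΨ0 := constantCoeff_yScale (k := k) γ₁
  have hmv : IsCountMove (m := 2) (fun i => subst (yScale γ₁) (extendLast τ i)) (fun _ => 1) := by
    refine ⟨fun i => constantCoeff_comp_eq_zero hΘ₁0 hΨ0 i, ?_, fun _ => le_rfl, ⟨0, Nat.one_pos⟩⟩
    change IsUnit (FormalCoordChange.linMat (fun i => subst (yScale γ₁) (extendLast τ i))).det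
    rw [linMat_comp (extendLast τ) hΨ0, Matrix.det_mul, det_linMat_extendLast, det_linMat_yScale]
    exact hτdet.mul (isUnit_iff_ne_zero.mpr hγ₁)
  refine isBPermissible_point hmv fun l _ => ?_
  rcases Fin.eq_castSucc_or_eq_last l with ⟨i, rfl⟩ | rfl
  · obtain ⟨j, a, ha, hτi⟩ := hτX i
    refine ⟨Fin.castSucc j, C a, by rw [constantCoeff_C]; exact ha, ?_⟩
    have h := image_X (γ₁ := γ₁) hτ0 hτi
    rwa [subst_X (hasSubst_of_constantCoeff_zero hΘ₁0)] at h
  · refine ⟨Fin.last 2, C γ₁, by rw [constantCoeff_C]; exact hγ₁, ?_⟩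
    show subst (yScale γ₁) (extendLast τ (Fin.last 2)) = C γ₁ * X (Fin.last 2)
    rw [extendLast_last, subst_X (hasSubst_of_constantCoeff_zero hΨ0), yScale, if_pos rfl]

/-- The successor coordinates on a `u`-letter: `u_i ↦ a · u_j`. -/
theorem sliceTheta_castSucc {γ₁ : k} (τ : Fin 2 → MvPowerSeries (Fin 2) k) (hτ0 : ∀ i, constantCoeff (τ i) = 0) {i j : Fin 2} {a : k}
    (h : τ i = C a * X j) : subst (yScale γ₁) (extendLast τ (Fin.castSucc i)) = C a * X (Fin.castSucc j) := by
  have h' := image_X (γ₁ := γ₁) hτ0 h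
  rwa [subst_X (hasSubst_of_constantCoeff_zero (constantCoeff_extendLast' τ hτ0))] at h'

/-- The successor coordinates on `y`: `y ↦ γ₁ y`. -/
theorem sliceTheta_last (γ₁ : k) (τ : Fin 2 → MvPowerSeries (Fin 2) k) :
    subst (yScale γ₁) (extendLast τ (Fin.last 2)) = C γ₁ * X (Fin.last 2) := by
  rw [extendLast_last, subst_X (hasSubst_of_constantCoeff_zero (constantCoeff_yScale γ₁)), yScale, if_pos rfl]

end NCPoly

namespace TameFourTupleDrop

/-! ## The transfer -/

/-- **TRANSFER OF A PRESENTATION TO THE SUCCESSOR COORDINATES.**  If `f′ · ∏_{O′} x_l = V · monicGerm d S` with `S_j = γ₁^{d−j} · (L_j ∘ σ)`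
(`γ₁ ≠ 0`), `τ` a (swap-)diagonal inverse of `σ`, then `Θ′ = (extendLast τ) ∘ (yScale γ₁)` — legal, straightening every letter, `u`-letters to
`u`-letters, `y ↦ γ₁ y` — presents the state by `L`: `(f′ · ∏_{O′} x_l) ∘ Θ′ = H′ · monicGerm d L` with `H′(0) ≠ 0`. -/
theorem Decoration.presentation_of_sliceData {δ' : Decoration k 2} {d : ℕ} (L S : Fin d → MvPowerSeries (Fin 2) k) {γ₁ : k} (hγ₁ : γ₁ ≠ 0)
    (σ τ : Fin 2 → MvPowerSeries (Fin 2) k) (hσ0 : ∀ i, constantCoeff (σ i) = 0) (hτ0 : ∀ i, constantCoeff (τ i) = 0)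
    (hτdet : IsUnit (FormalCoordChange.linMat τ).det) (hcomp : ∀ s, subst τ (σ s) = X s)
    (hτX : ∀ i, ∃ (j : Fin 2) (a : k), a ≠ 0 ∧ τ i = C a * X j)
    (hS : ∀ j, S j = C (γ₁ ^ (d - (j : ℕ))) * subst σ (L j)) {V : MvPowerSeries (Fin 3) k} (hV : constantCoeff V ≠ 0)
    (heq : δ'.f * ∏ l ∈ δ'.O, X l = V * NCPoly.monicGerm d S) :
    ∃ (Θ' : Fin 3 → MvPowerSeries (Fin 3) k) (H' : MvPowerSeries (Fin 3) k),
      IsBPermissible δ' Θ' (fun _ => 1) ∧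
      (∀ i : Fin 2, ∃ (j : Fin 2) (a : k), a ≠ 0 ∧ Θ' (Fin.castSucc i) = C a * X (Fin.castSucc j)) ∧
      Θ' (Fin.last 2) = C γ₁ * X (Fin.last 2) ∧ constantCoeff H' ≠ 0 ∧
      subst Θ' (δ'.f * ∏ l ∈ δ'.O, X l) = H' * NCPoly.monicGerm d L := by
  have hτS : ∀ j, subst τ (S j) = C (γ₁ ^ (d - (j : ℕ))) * L j := fun j => by
    rw [hS j, PolyDescent.subst_C_mul_of_constantCoeff_zero τ hτ0, subst_subst_of_comp_eq_X hσ0 hτ0 hcomp (L j)]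
  have hΘ₁0 := NCPoly.constantCoeff_extendLast' τ hτ0
  have hΘ₁s := hasSubst_of_constantCoeff_zero hΘ₁0
  have hΨ0 := NCPoly.constantCoeff_yScale (k := k) γ₁
  have hΨs := hasSubst_of_constantCoeff_zero hΨ0
  have himGerm : subst (NCPoly.yScale γ₁) (subst (NCPoly.extendLast τ) (NCPoly.monicGerm d S)) = C (γ₁ ^ d) * NCPoly.monicGerm d L := by
    rw [NCPoly.subst_extendLast_monicGerm τ hτ0,
      show (fun j : Fin d => subst τ (S j)) = fun j : Fin d => C (γ₁ ^ (d - (j : ℕ))) * L j from funext hτS, NCPoly.subst_yScale_monicGerm]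
  set W : MvPowerSeries (Fin 3) k := subst (NCPoly.yScale γ₁) (subst (NCPoly.extendLast τ) V) with hW
  have hW0 : constantCoeff W ≠ 0 := by
    rw [hW, constantCoeff_subst_of_constantCoeff_zero _ hΨ0, constantCoeff_subst_of_constantCoeff_zero _ hΘ₁0]; exact hV
  refine ⟨fun i => subst (NCPoly.yScale γ₁) (NCPoly.extendLast τ i), W * C (γ₁ ^ d),
    NCPoly.isBPermissible_point_sliceTheta δ' hγ₁ τ hτ0 hτdet hτX, fun i => ?_, NCPoly.sliceTheta_last γ₁ τ, ?_, ?_⟩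
  · obtain ⟨j, a, ha, hτi⟩ := hτX i
    exact ⟨j, a, ha, NCPoly.sliceTheta_castSucc τ hτ0 hτi⟩
  · rw [map_mul, constantCoeff_C]; exact mul_ne_zero hW0 (pow_ne_zero d hγ₁)
  · rw [← subst_subst_eq_subst_comp hΘ₁0 hΨ0, heq, ← coe_substAlgHom hΘ₁s, map_mul, ← coe_substAlgHom hΨs, map_mul, coe_substAlgHom,
      coe_substAlgHom, himGerm, ← hW]
    ring

/-! ## The four near answers of a presented state -/

section Near

variable {b : MvPowerSeries (Fin (2 + 1)) k} {δ : Decoration k 2} {Φ₀ : Fin (2 + 1) → MvPowerSeries (Fin (2 + 1)) k} {d : ℕ}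
  {A : Fin d → MvPowerSeries (Fin 2) k} {U : MvPowerSeries (Fin (2 + 1)) k}

/-- **POINT MOVE, ANSWER `γ = 0`, `c₀ ≠ 0` (slot `u₁`), SAME HEAD**: the new state is presented by the label `blowOneT d (shearT (C (c₁/c₀)) A)`. -/
theorem Decoration.presentation_pointSucc_zero (hperm : IsBPermissible δ Φ₀ (fun _ => 1)) (hf : δ.f ≠ 0) (hU : constantCoeff U ≠ 0)
    (hA : PolyDescent.IsPosT d A) (hP : subst Φ₀ (δ.f * ∏ l ∈ δ.O, X l) = U * NCPoly.monicGerm d A)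
    {pt : Fin (2 + 1) → k} (hγ : pt (Fin.last 2) = 0) (hc0 : pt 0 ≠ 0)
    (hnear : (δ.transform Φ₀ (fun _ => 1) pt (Fin.castSucc 0)).o = δ.o) :
    ∃ (Θ' : Fin 3 → MvPowerSeries (Fin 3) k) (H' : MvPowerSeries (Fin 3) k),
      IsBPermissible (δ.transform Φ₀ (fun _ => 1) pt (Fin.castSucc 0)) Θ' (fun _ => 1) ∧
      (∀ i : Fin 2, ∃ (j : Fin 2) (a : k), a ≠ 0 ∧ Θ' (Fin.castSucc i) = C a * X (Fin.castSucc j)) ∧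
      Θ' (Fin.last 2) = C (pt 0) * X (Fin.last 2) ∧ constantCoeff H' ≠ 0 ∧
      subst Θ' ((δ.transform Φ₀ (fun _ => 1) pt (Fin.castSucc 0)).f * ∏ l ∈ (δ.transform Φ₀ (fun _ => 1) pt (Fin.castSucc 0)).O, X l) =
        H' * NCPoly.monicGerm d (PolyDescent.blowOneT d (PolyDescent.shearT (C (pt 1 / pt 0)) A)) := by
  classical
  have hci₀ : pt (Fin.castSucc (0 : Fin 2)) ≠ 0 := hc0
  obtain ⟨B, V, hB, hV, heq⟩ := totalO_transform_eq_of_near hperm hf hU hA hP hγ hci₀ hnear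
  set τ : Fin 2 → MvPowerSeries (Fin 2) k := PlaneGerm.diagScale (pt 0)⁻¹ (pt 0) with hτ
  have hτ0 : ∀ i, constantCoeff (τ i) = 0 := PlaneGerm.constantCoeff_diagScale _ _
  have hτs := hasSubst_of_constantCoeff_zero hτ0
  have hτ_apply0 : τ 0 = C (pt 0)⁻¹ * X 0 := by simp [hτ, PlaneGerm.diagScale]
  have hτ_apply1 : τ 1 = C (pt 0) * X 1 := by simp [hτ, PlaneGerm.diagScale]
  refine Decoration.presentation_of_sliceData _ (fun j => TupleGame.slice (0 : Fin 2) (X 0 * B j)) hc0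
    (PlaneGerm.diagScale (pt 0) (pt 0)⁻¹) τ (PlaneGerm.constantCoeff_diagScale _ _) hτ0
    (by rw [hτ, WildPurePower.linMat_diagScale_det, inv_mul_cancel₀ hc0]; exact isUnit_one) (fun s => ?_)
    (fun i => ?_) (fun j => ?_) hV heq
  · fin_cases s
    · show subst τ (PlaneGerm.diagScale (pt 0) (pt 0)⁻¹ 0) = X 0
      have h0 : PlaneGerm.diagScale (pt 0) (pt 0)⁻¹ 0 = C (pt 0) * X 0 := by simp [PlaneGerm.diagScale]
      rw [h0, PolyDescent.subst_C_mul_of_constantCoeff_zero τ hτ0, subst_X hτs, hτ_apply0, ← mul_assoc, ← map_mul,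
        mul_inv_cancel₀ hc0, map_one, one_mul]
    · show subst τ (PlaneGerm.diagScale (pt 0) (pt 0)⁻¹ 1) = X 1
      have h1 : PlaneGerm.diagScale (pt 0) (pt 0)⁻¹ 1 = C (pt 0)⁻¹ * X 1 := by simp [PlaneGerm.diagScale]
      rw [h1, PolyDescent.subst_C_mul_of_constantCoeff_zero τ hτ0, subst_X hτs, hτ_apply1, ← mul_assoc, ← map_mul,
        inv_mul_cancel₀ hc0, map_one, one_mul]
  · fin_cases i
    · exact ⟨0, (pt 0)⁻¹, inv_ne_zero hc0, hτ_apply0⟩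
    · exact ⟨1, pt 0, hc0, hτ_apply1⟩
  · have h := PolyDescent.slice_zero_eq_blowOneT (fun l => pt (Fin.castSucc l)) A B hB hc0 j
    rw [PolyDescent.diagFamily_eq_diagScale] at h
    exact h

/-- **POINT MOVE, ANSWER `γ = 0`, `c₀ = 0`, `c₁ ≠ 0` (slot `u₂`), SAME HEAD**: the new state is presented by the label `blowTwoT d A`. -/
theorem Decoration.presentation_pointSucc_one (hperm : IsBPermissible δ Φ₀ (fun _ => 1)) (hf : δ.f ≠ 0) (hU : constantCoeff U ≠ 0)
    (hA : PolyDescent.IsPosT d A) (hP : subst Φ₀ (δ.f * ∏ l ∈ δ.O, X l) = U * NCPoly.monicGerm d A)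
    {pt : Fin (2 + 1) → k} (hγ : pt (Fin.last 2) = 0) (hc0 : pt 0 = 0) (hc1 : pt 1 ≠ 0)
    (hnear : (δ.transform Φ₀ (fun _ => 1) pt (Fin.castSucc 1)).o = δ.o) :
    ∃ (Θ' : Fin 3 → MvPowerSeries (Fin 3) k) (H' : MvPowerSeries (Fin 3) k),
      IsBPermissible (δ.transform Φ₀ (fun _ => 1) pt (Fin.castSucc 1)) Θ' (fun _ => 1) ∧
      (∀ i : Fin 2, ∃ (j : Fin 2) (a : k), a ≠ 0 ∧ Θ' (Fin.castSucc i) = C a * X (Fin.castSucc j)) ∧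
      Θ' (Fin.last 2) = C (pt 1) * X (Fin.last 2) ∧ constantCoeff H' ≠ 0 ∧
      subst Θ' ((δ.transform Φ₀ (fun _ => 1) pt (Fin.castSucc 1)).f * ∏ l ∈ (δ.transform Φ₀ (fun _ => 1) pt (Fin.castSucc 1)).O, X l) =
        H' * NCPoly.monicGerm d (PolyDescent.blowTwoT d A) := by
  classical
  have hci₀ : pt (Fin.castSucc (1 : Fin 2)) ≠ 0 := hc1
  obtain ⟨B, V, hB, hV, heq⟩ := totalO_transform_eq_of_near hperm hf hU hA hP hγ hci₀ hnear
  set τ : Fin 2 → MvPowerSeries (Fin 2) k :=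
    fun l => if l = 0 then C (pt 1)⁻¹ * X 1 else C (pt 1) * (X 0 : MvPowerSeries (Fin 2) k) with hτ
  have hτ0 : ∀ i, constantCoeff (τ i) = 0 := PureDescent.constantCoeff_swapDiag _ _
  have hτs := hasSubst_of_constantCoeff_zero hτ0
  have hτ_apply0 : τ 0 = C (pt 1)⁻¹ * X 1 := by simp [hτ]
  have hτ_apply1 : τ 1 = C (pt 1) * X 0 := by simp [hτ]
  refine Decoration.presentation_of_sliceData _ (fun j => TupleGame.slice (1 : Fin 2) (X 0 * B j)) hc1 τ τ hτ0 hτ0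
    (by rw [hτ]; exact PureDescent.isUnit_det_swapDiag (inv_ne_zero hc1) hc1) (fun s => ?_) (fun i => ?_)
    (fun j => PolyDescent.slice_one_eq_blowTwoT (fun l => pt (Fin.castSucc l)) A B hB hc0 hc1 j) hV heq
  · fin_cases s
    · show subst τ (τ 0) = X 0
      rw [hτ_apply0, PolyDescent.subst_C_mul_of_constantCoeff_zero τ hτ0, subst_X hτs, hτ_apply1, ← mul_assoc, ← map_mul,
        inv_mul_cancel₀ hc1, map_one, one_mul]
    · show subst τ (τ 1) = X 1
      rw [hτ_apply1, PolyDescent.subst_C_mul_of_constantCoeff_zero τ hτ0, subst_X hτs, hτ_apply0, ← mul_assoc, ← map_mul,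
        mul_inv_cancel₀ hc1, map_one, one_mul]
  · fin_cases i
    · exact ⟨1, (pt 1)⁻¹, inv_ne_zero hc1, hτ_apply0⟩
    · exact ⟨0, pt 1, hc1, hτ_apply1⟩

/-- **CURVE MOVE `V(y,u₁)`, ANSWER `γ = 0` (slot `u₁`, `c₀ ≠ 0`), SAME HEAD**: the new state is presented by the label `A′ = A / u₁^{d−·}`. -/
theorem Decoration.presentation_curveSucc_zero (hperm₁ : IsBPermissible δ Φ₀ (fun _ => 1)) (hf : δ.f ≠ 0) (hU : constantCoeff U ≠ 0)
    {A' : Fin d → MvPowerSeries (Fin 2) k} (hdiv : ∀ j, A j = X 0 ^ (d - (j : ℕ)) * A' j)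
    (hP : subst Φ₀ (δ.f * ∏ l ∈ δ.O, X l) = U * NCPoly.monicGerm d A)
    {pt : Fin (2 + 1) → k} (hconv : ∀ l, (fun l : Fin (2 + 1) => if l = Fin.castSucc 0 ∨ l = Fin.last 2 then (1 : ℕ) else 0) l = 0 → pt l = 0)
    (hγ : pt (Fin.last 2) = 0) (hc0 : pt (Fin.castSucc 0) ≠ 0)
    (hnear : (δ.transform Φ₀ (fun l : Fin (2 + 1) => if l = Fin.castSucc 0 ∨ l = Fin.last 2 then (1 : ℕ) else 0) pt (Fin.castSucc 0)).o = δ.o) :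
    ∃ (Θ' : Fin 3 → MvPowerSeries (Fin 3) k) (H' : MvPowerSeries (Fin 3) k),
      IsBPermissible (δ.transform Φ₀ (fun l : Fin (2 + 1) => if l = Fin.castSucc 0 ∨ l = Fin.last 2 then (1 : ℕ) else 0) pt (Fin.castSucc 0))
        Θ' (fun _ => 1) ∧
      (∀ i : Fin 2, ∃ (j : Fin 2) (a : k), a ≠ 0 ∧ Θ' (Fin.castSucc i) = C a * X (Fin.castSucc j)) ∧
      Θ' (Fin.last 2) = C (pt (Fin.castSucc 0)) * X (Fin.last 2) ∧ constantCoeff H' ≠ 0 ∧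
      subst Θ' ((δ.transform Φ₀ (fun l : Fin (2 + 1) => if l = Fin.castSucc 0 ∨ l = Fin.last 2 then (1 : ℕ) else 0) pt (Fin.castSucc 0)).f *
          ∏ l ∈ (δ.transform Φ₀ (fun l : Fin (2 + 1) => if l = Fin.castSucc 0 ∨ l = Fin.last 2 then (1 : ℕ) else 0) pt (Fin.castSucc 0)).O, X l) =
        H' * NCPoly.monicGerm d A' := by
  classical
  obtain ⟨V, hV, heq⟩ := totalO_transform_curve_eq_of_near' hperm₁ hf hU hP hdiv hconv hγ hc0 hnear
  set ci : k := pt (Fin.castSucc 0) with hci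
  set τ : Fin 2 → MvPowerSeries (Fin 2) k := PlaneGerm.diagScale ci⁻¹ 1 with hτ
  have hτ0 : ∀ i, constantCoeff (τ i) = 0 := PlaneGerm.constantCoeff_diagScale _ _
  have hτs := hasSubst_of_constantCoeff_zero hτ0
  have hτ_apply0 : τ 0 = C ci⁻¹ * X 0 := by simp [hτ, PlaneGerm.diagScale]
  have hτ_apply1 : τ 1 = C 1 * X 1 := by simp [hτ, PlaneGerm.diagScale]
  refine Decoration.presentation_of_sliceData A'
    (fun j => C (ci ^ (d - (j : ℕ))) * TupleGame.slice (0 : Fin 2)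
      (subst (CobordantChart.chart (fun l : Fin 2 => if l = 0 then (1 : ℕ) else 0) (fun l : Fin 2 => if l = 0 then ci else 0)) (A' j)))
    hc0 (PlaneGerm.diagScale ci 1) τ (PlaneGerm.constantCoeff_diagScale _ _) hτ0
    (by rw [hτ, WildPurePower.linMat_diagScale_det, mul_one]; exact isUnit_iff_ne_zero.mpr (inv_ne_zero hc0)) (fun s => ?_)
    (fun i => ?_) (fun j => ?_) hV heq
  · fin_cases s
    · show subst τ (PlaneGerm.diagScale ci 1 0) = X 0
      have h0 : PlaneGerm.diagScale ci (1 : k) 0 = C ci * X 0 := by simp [PlaneGerm.diagScale]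
      rw [h0, PolyDescent.subst_C_mul_of_constantCoeff_zero τ hτ0, subst_X hτs, hτ_apply0, ← mul_assoc, ← map_mul,
        mul_inv_cancel₀ hc0, map_one, one_mul]
    · show subst τ (PlaneGerm.diagScale ci 1 1) = X 1
      have h1 : PlaneGerm.diagScale ci (1 : k) 1 = C 1 * X 1 := by simp [PlaneGerm.diagScale]
      rw [h1, PolyDescent.subst_C_mul_of_constantCoeff_zero τ hτ0, subst_X hτs, hτ_apply1, map_one, one_mul, one_mul]
  · fin_cases i
    · exact ⟨0, ci⁻¹, inv_ne_zero hc0, hτ_apply0⟩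
    · exact ⟨1, 1, one_ne_zero, hτ_apply1⟩
  · have h := PolyDescent.curveSlice_zero_eq' ci A' j
    rw [PolyDescent.diagFamily_eq_diagScale] at h
    exact h

/-- **CURVE MOVE `V(y,u₂)`, ANSWER `γ = 0` (slot `u₂`, `c₁ ≠ 0`), SAME HEAD**: the new state is presented by the label `A′ = A / u₂^{d−·}`. -/
theorem Decoration.presentation_curveSucc_one (hperm₁ : IsBPermissible δ Φ₀ (fun _ => 1)) (hf : δ.f ≠ 0) (hU : constantCoeff U ≠ 0)
    {A' : Fin d → MvPowerSeries (Fin 2) k} (hdiv : ∀ j, A j = X 1 ^ (d - (j : ℕ)) * A' j)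
    (hP : subst Φ₀ (δ.f * ∏ l ∈ δ.O, X l) = U * NCPoly.monicGerm d A)
    {pt : Fin (2 + 1) → k} (hconv : ∀ l, (fun l : Fin (2 + 1) => if l = Fin.castSucc 1 ∨ l = Fin.last 2 then (1 : ℕ) else 0) l = 0 → pt l = 0)
    (hγ : pt (Fin.last 2) = 0) (hc1 : pt (Fin.castSucc 1) ≠ 0)
    (hnear : (δ.transform Φ₀ (fun l : Fin (2 + 1) => if l = Fin.castSucc 1 ∨ l = Fin.last 2 then (1 : ℕ) else 0) pt (Fin.castSucc 1)).o = δ.o) :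
    ∃ (Θ' : Fin 3 → MvPowerSeries (Fin 3) k) (H' : MvPowerSeries (Fin 3) k),
      IsBPermissible (δ.transform Φ₀ (fun l : Fin (2 + 1) => if l = Fin.castSucc 1 ∨ l = Fin.last 2 then (1 : ℕ) else 0) pt (Fin.castSucc 1))
        Θ' (fun _ => 1) ∧
      (∀ i : Fin 2, ∃ (j : Fin 2) (a : k), a ≠ 0 ∧ Θ' (Fin.castSucc i) = C a * X (Fin.castSucc j)) ∧
      Θ' (Fin.last 2) = C (pt (Fin.castSucc 1)) * X (Fin.last 2) ∧ constantCoeff H' ≠ 0 ∧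
      subst Θ' ((δ.transform Φ₀ (fun l : Fin (2 + 1) => if l = Fin.castSucc 1 ∨ l = Fin.last 2 then (1 : ℕ) else 0) pt (Fin.castSucc 1)).f *
          ∏ l ∈ (δ.transform Φ₀ (fun l : Fin (2 + 1) => if l = Fin.castSucc 1 ∨ l = Fin.last 2 then (1 : ℕ) else 0) pt (Fin.castSucc 1)).O, X l) =
        H' * NCPoly.monicGerm d A' := by
  classical
  obtain ⟨V, hV, heq⟩ := totalO_transform_curve_eq_of_near' hperm₁ hf hU hP hdiv hconv hγ hc1 hnear
  set ci : k := pt (Fin.castSucc 1) with hci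
  set τ : Fin 2 → MvPowerSeries (Fin 2) k :=
    fun l => if l = 0 then C ci⁻¹ * X 1 else C 1 * (X 0 : MvPowerSeries (Fin 2) k) with hτ
  have hτ0 : ∀ i, constantCoeff (τ i) = 0 := PureDescent.constantCoeff_swapDiag _ _
  have hτs := hasSubst_of_constantCoeff_zero hτ0
  have hτ_apply0 : τ 0 = C ci⁻¹ * X 1 := by simp [hτ]
  have hτ_apply1 : τ 1 = C 1 * X 0 := by simp [hτ]
  set σ : Fin 2 → MvPowerSeries (Fin 2) k :=
    fun l => if l = 0 then C 1 * X 1 else C ci * (X 0 : MvPowerSeries (Fin 2) k) with hσ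
  have hσ0 : ∀ i, constantCoeff (σ i) = 0 := PureDescent.constantCoeff_swapDiag _ _
  refine Decoration.presentation_of_sliceData A'
    (fun j => C (ci ^ (d - (j : ℕ))) * TupleGame.slice (1 : Fin 2)
      (subst (CobordantChart.chart (fun l : Fin 2 => if l = 1 then (1 : ℕ) else 0) (fun l : Fin 2 => if l = 1 then ci else 0)) (A' j)))
    hc1 σ τ hσ0 hτ0 (by rw [hτ]; exact PureDescent.isUnit_det_swapDiag (inv_ne_zero hc1) one_ne_zero) (fun s => ?_)
    (fun i => ?_) (fun j => PolyDescent.curveSlice_one_eq' ci A' j) hV heq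
  · fin_cases s
    · show subst τ (σ 0) = X 0
      have h0 : σ 0 = C 1 * X 1 := by simp [hσ]
      rw [h0, PolyDescent.subst_C_mul_of_constantCoeff_zero τ hτ0, subst_X hτs, hτ_apply1, map_one, one_mul, one_mul]
    · show subst τ (σ 1) = X 1
      have h1 : σ 1 = C ci * X 0 := by simp [hσ]
      rw [h1, PolyDescent.subst_C_mul_of_constantCoeff_zero τ hτ0, subst_X hτs, hτ_apply0, ← mul_assoc, ← map_mul,
        mul_inv_cancel₀ hc1, map_one, one_mul]
  · fin_cases i
    · exact ⟨1, ci⁻¹, inv_ne_zero hc1, hτ_apply0⟩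
    · exact ⟨0, 1, one_ne_zero, hτ_apply1⟩

end Near

end TameFourTupleDrop

end Summit.ResolutionOfSingularities.ResolutionOfSingularities.Theorems

end
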